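import Summits.HubbardSuperconductivity.HubbardSuperconductivity.Theorems.AnisotropyChordTransferFibre3FinMHoleL10a
import Summits.HubbardSuperconductivity.HubbardSuperconductivity.Theorems.AnisotropyChordTransferFibre3FinMHoleL10b
import Summits.HubbardSuperconductivity.HubbardSuperconductivity.Theorems.AnisotropyChordTransferFibre3FinMHoleL10c
import Summits.HubbardSuperconductivity.HubbardSuperconductivity.Theorems.AnisotropyChordTransferFibre3FinMHoleL10d

/-!
# Route `AnisotropyChord` / H0 rotor rung: ★ the regime clause `mHole ≥ 0` at `L = 10` for EVERY ground profile (FIN-class, kernel-certified)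

`mHole_nonneg_ten`: for every `0 < Δ < 1` and every ground two-magnon profile `f` at `L = 10`, `0 ≤ mHole 10 Δ f`, i.e.
`T⁺ ≤ ε₁(1 − 5/V + 6/V²)/2` — the first half of the regime clause of the GM₃ assembly `gm3_allL` at this `L`, by the FIN
evaluator in convolution form (`…FinConvCell`, soundness `…FinMHoleConv.mHole_nonneg_of_cells3`, kernel facts `…FinMHoleL10*`).
Prover seat `hubbard-h0-rotor-p3` g4; helper for stmt-HubbardSuperconductivity-23918 (piece A of rung 19089; `--supports`, helper class).
WHAT THIS IS NOT: nothing here proves superconductivity in the Hubbard model (rotor TARGET as worded stays FALSE, g15 verdict); one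
hypothesis of ONE conditional reduction at one `L`; the three β-free cruxes and the side condition remain. Tree imports only; no sorry.
-/

set_option linter.dupNamespace false
set_option autoImplicit false

namespace Summit.HubbardSuperconductivity.HubbardSuperconductivity.Theorems.AnisotropyChord.Transfer.Fibre3

namespace FinCell

/-- the cell list at `L = 10` (14 points in units of `2^60`, from `0` to `≥ lamTop 10`) passes cellwise. [folklore] -/
theorem cellsAll_ten : cellsAll (mholeCellOK3 10) [0, 1117406156598256, 2905256007155465, 5765815768047000, 10342711385473456, 14004227879414620, 16933441074567552, 21620182186812244, 25369575076608000, 26869332232526304, 29268943681995592, 33108322001146452, 39251327311787824, 44696246263930232] = true := by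
  simp only [cellsAll, cell10_1, cell10_2, cell10_3, cell10_4, cell10_5, cell10_6, cell10_7, cell10_8, cell10_9, cell10_10, cell10_11, cell10_12, cell10_13, Bool.true_and]

/-- kernel fact: the cell list at `L = 10` is a certificate (`mholeCheck3`): head `0`, length, `lamTop 10 ≤` last point, all cells. [folklore] -/
theorem mholeCheck3_ten : mholeCheck3 10 [0, 1117406156598256, 2905256007155465, 5765815768047000, 10342711385473456, 14004227879414620, 16933441074567552, 21620182186812244, 25369575076608000, 26869332232526304, 29268943681995592, 33108322001146452, 39251327311787824, 44696246263930232] = true := by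
  unfold mholeCheck3
  rw [cellsAll_ten]
  decide +kernel

end FinCell

/-- ★★ THE REGIME CLAUSE `mHole ≥ 0` AT `L = 10`: every ground two-magnon profile at `L = 10`, `0 < Δ < 1`, has
`T⁺ ≤ ε₁(1 − 5/V + 6/V²)/2` (FIN-class, kernel-certified with zero data). [folklore] -/
theorem mHole_nonneg_ten {Δ : ℝ} (hΔ0 : 0 < Δ) (hΔ1 : Δ < 1) :
    ∀ lam2 : ℝ, ∀ f : Tor 10 → ℝ, IsGroundTwoMagnon 10 Δ lam2 f → 0 ≤ mHole 10 Δ f :=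
  FinCell.mHole_nonneg_of_cells3 10 (by norm_num) [0, 1117406156598256, 2905256007155465, 5765815768047000, 10342711385473456, 14004227879414620, 16933441074567552, 21620182186812244, 25369575076608000, 26869332232526304, 29268943681995592, 33108322001146452, 39251327311787824, 44696246263930232] FinCell.mholeCheck3_ten hΔ0 hΔ1

end Summit.HubbardSuperconductivity.HubbardSuperconductivity.Theorems.AnisotropyChord.Transfer.Fibre3
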